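import Mathlib
import Summits.MatrixMultiplication.MatrixMultiplication.Theses.SnSubsetDichotomy
import Literature.Barriers.MatrixMultiplication.NilpotentGroupBarrierSemisimple
import Literature.Barriers.MatrixMultiplication.NilpotentGroupBarrierGradedCoords
import Summits.MatrixMultiplication.MatrixMultiplication.Theorems.SnSubsetDichotomyNoThresholdSubsetTripleStubTransfer
import Summits.MatrixMultiplication.MatrixMultiplication.Theorems.SnSubsetDichotomyNoThresholdSubsetTripleStubCodim

/-!
# Line `two-modular-loewy-slice-rank` — skeleton for crux `SnSubsetDichotomy.NoThresholdSubsetTriple`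
# (stmt-MatrixMultiplication-8302, route-MatrixMultiplication-SnSubsetDichotomy; crux-plan, round 1)

**Idea (card `two-modular-loewy-slice-rank`, ideator 1; triage r1-1/2/3: pass ×3, merge-candidate with
`klr-graded-codimension`).** The crux `∃ c > 0, n₀, ∀ n ≥ n₀, every TPP triple S,T,U ⊆ S_n has
|S||T||U| ≤ (n!)^{3/2}·e^{−c√n}` is TRANSFERRED (stub 1, `stub_transfer`, provable now) to the
two-modular slice-rank saving `C⁺`: `slice-rank_𝕜 D_{S_n} ≤ n!·e^{−K√n}` for the group tensor
`D_{S_n}(x,y,z) = [xyz = 1]` (`mulGroupTensor`) over `𝕜 = 𝔽̄₂` — packing (`RealizesTPP.mul_le_card`)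
makes a threshold triple balanced, heredity (`TripleProductProperty.mono`) shrinks it to three `N`-sets,
and the tree THEOREM `BCCGU2017_propB6.sq_le_sliceRank_of_realizesTPP` + `BCCGU2017_propB6_holds`
(Cohn–Umans embedding of `⟨N,N,N⟩` + Prop. B.6 over every field) gives `N² ≤ slice-rank`, so `c = K/2`.
`C⁺` itself is cut along Blasiak–Church–Cohn–Grochow–Umans 2017, Prop. 3.2 / Lemma 3.3 (held text
`paper:arxiv-1712.02302` p. 5: Prop. 13 "subspaces `A·B ⊆ C` of an algebra give
`slice-rank ≤ codim A + codim B + dim C`"; Lemma 14 "for an ideal `I`: `≤ codim I^a + codim I^b +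
dim I^{a+b}`") with `I = J := rad 𝕜[S_n]`, the Loewy (radical) filtration — the one multiplicative
ℕ-filtration every non-semisimple algebra carries:

* `stub_codim` (M–L, provable now): Prop. 3.2 in the tree's coordinates (`sliceRank`, `mulGroupTensor`,
  `Submodule F (MonoidAlgebra F G)`), three adapted bases + `HasSliceRankLE.of_graded`/`subst_*`.
* `stub_semisimpleFloor` (L–XL, known mathematics): LAYER 0 is thin —
  `dim 𝕜[S_n]/J = Σ_{λ 2-regular} (dim D^λ)² ≤ Σ_{λ strict} (f^λ)² = n!·Pl_n(strict) ≤ n!·e^{−K√n}`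
  (James: `D^λ` is a quotient of `S^λ` for `λ` 2-regular = strict; Schensted/RSK: strict shape ⇒
  longest decreasing subsequence `≤ √(2n)`, a macroscopic lower deviation of `LDS/√n → 2`;
  Talagrand / Deuschel–Zeitouni lower tail).  This is the quantitative form of the evasion of
  Cor. B.7 ("semisimple ⇒ full slice rank") and also Pratt's floor `SR ≥ dim A/J` (arXiv:2210.05488).
* `stub_radicalWindow` (XL, OPEN — the load-bearing bet): LAYERS ≥ 1 of the radical filtration
  `J ⊋ J² ⊋ …` of `𝕜[S_n]` carry all but `n!·e^{−K√n}` of their mass in a window `[b, a+b)` with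
  `a ≤ b` ("middle-heavy Loewy profile": `Σ_{1≤i<max(a,b)} r_i + Σ_{i ≥ a+b} r_i` thin,
  `r_i = dim J^i/J^{i+1}`).

The sorry-free glue proves `twoModularSliceRank_of_stubs : C⁺` (stub 2 at `A = J^a, B = J^b,
C = J^{a+b}`, `J^a·J^b = J^{a+b}` by `pow_add`, `|S_n| = n!`; the identity
`(n! − dim J^a) = (n! − dim J) + (dim J − dim J^a)`; rates `K := min(K₁,K₂)/2`, the constant `3`
absorbed by `3 ≤ e^{(K/2)√n}` eventually, `eventually_three_le_exp`) and the composition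
`NoThresholdSubsetTriple_of : NoThresholdSubsetTriple` (no hypotheses; `sorry` only inside `stub_*`).

**Disproof used** (cdisprove v1–v6; the file `run/gate/evidence/…/Disproof.lean` is not mounted in this
seat — read through the item's evidence notes, as the three triagers did; no `Negative/` lemma has landed
under `Theorems/NoThresholdSubsetTriple/`, nothing to import): `false_without_TPP` — the TPP is consumed
exactly once, in `stub_transfer`, through `RealizesTPP` (with `S = T = U = S_n` slice rank says nothing);
`holds_without_posConst` / `packing_bound` — every `K > 0` of the line comes from stubs 3–4, i.e. from a
slice-rank bound STRICTLY below the packing value `n! = sliceRank_le_card`; `false_without_n0` — `C⁺` and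
all stubs are eventual in `n` (`𝔽₂S_n` has full slice rank for `n ≤ 3`); `false_with_pairwise_only` —
`RealizesTPP.tensorRestrictsTo` uses the genuine three-fold condition; §8 `card_gt/lt_of_threshold` — the
balanced sub-triple step of `stub_transfer` is that lemma; `crux_holds_for_young_triples` — consistent:
Young triples force `slice-rank_F D_{S_n} ≥ n!·e^{−O(n)}` over every field, compatible with `e^{−K√n}`.
No stub is an instance of a refuted statement (`ledger negatives MatrixMultiplication`: 9732, 9721, 8036 —
STPP line/frame designs and design flattening, unrelated).
-/

namespace Summit.MatrixMultiplication.MatrixMultiplication.Cruxes.NoThresholdSubsetTriple.TwoModularLoewySliceRank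

open scoped BigOperators
open Literature.Barriers.MatrixMultiplication Literature.Combinatorics.Additive
open Literature.Computability.AlgebraicComplexity
open Summit.MatrixMultiplication.MatrixMultiplication.Theses.SnSubsetDichotomy

set_option linter.dupNamespace false

/-- The coefficient field of the line: an algebraic closure `𝕜 = 𝔽̄₂` of `𝔽₂ = ZMod 2`
(all dimensions below are the same over `𝔽₂`, which is a splitting field of `S_n`; slice rank can only
drop under extension of scalars, `sliceRank_map_le`, so `𝔽̄₂` is the weakest choice for `C⁺`). -/
local notation "𝕜" => AlgebraicClosure (ZMod 2)

/-- `J⟦n⟧` = the Jacobson radical `J(𝕜[S_n])` (Mathlib `Ring.jacobson`, a two-sided ideal) viewed as a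
`𝕜`-subspace of the group algebra `MonoidAlgebra 𝕜 (Equiv.Perm (Fin n))`; its submodule powers
`J⟦n⟧ ^ a` are the radical powers `J^a` (Loewy / radical filtration), `J⟦n⟧ ^ 0 = 1 = 𝕜·1`. -/
local notation "J⟦" n "⟧" =>
  (Submodule.restrictScalars (AlgebraicClosure (ZMod 2))
    (Ring.jacobson (MonoidAlgebra (AlgebraicClosure (ZMod 2)) (Equiv.Perm (Fin n)))) :
      Submodule (AlgebraicClosure (ZMod 2))
        (MonoidAlgebra (AlgebraicClosure (ZMod 2)) (Equiv.Perm (Fin n))))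

/-! ## The four stubs -/

/-- **Stub 1 — the transfer `C⁺ → crux` (size M, provable now).**  Over ANY field `F`: if the slice
rank of `D_{S_n}(x,y,z) = [xyz = 1]` is eventually `≤ n!·e^{−K√n}` for some `K > 0`, then
`NoThresholdSubsetTriple` holds with `c := K/2` and the same `n₀`.
Proof: fix `n ≥ n₀` and a TPP triple `S, T, U`; if one set is empty the product is `0 ≤ RHS`; else the
TPP is invariant under cyclic rotation (`xyz = 1 ↔ yzx = 1`), so packing
(`RealizesTPP.mul_le_card`, three times) gives `|S||T|, |T||U|, |U||S| ≤ n!`; if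
`|S||T||U| > (n!)^{3/2}e^{−c√n}` then `N := min(|S|,|T|,|U|) > √(n!)·e^{−c√n}`, i.e.
`N² > n!·e^{−2c√n} = n!·e^{−K√n}`; shrink to sub-`N`-sets (`Finset.exists_subset_card_eq`,
`TripleProductProperty.mono`) to get `RealizesTPP (Equiv.Perm (Fin n)) N N N`, whence
`N² ≤ sliceRank (mulGroupTensor F _)` by the tree THEOREM
`BCCGU2017_propB6.sq_le_sliceRank_of_realizesTPP BCCGU2017_propB6_holds` — contradiction with `C⁺`.
Real bookkeeping as in the route's `closes` (`Real.rpow_natCast`, `Real.sqrt_eq_rpow`, `Real.exp_add`,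
`Real.lt_sqrt`, `Nat.cast_le`).  Honours `false_without_TPP` (TPP used here, essentially),
`false_with_pairwise_only` (three-fold condition inside `tensorRestrictsTo`) and §8 (balanced sub-triple).
[BlasiakChurchCohnGrochowUmans2017 = arXiv:1712.02302, Prop. B.6, §6 p. 11; CohnUmans2003 Thm 2.3;
tree: `RealizesTPP.tensorRestrictsTo`, `sliceRank_le_of_tensorRestrictsTo`, `sliceRank_groupTensor`] -/
theorem stub_transfer (F : Type) [Field F]
    (hC : ∃ K : ℝ, 0 < K ∧ ∃ n₀ : ℕ, ∀ n ≥ n₀,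
      (sliceRank (mulGroupTensor F (Equiv.Perm (Fin n))) : ℝ) ≤
        (n.factorial : ℝ) * Real.exp (-(K * Real.sqrt (n : ℝ)))) :
    NoThresholdSubsetTriple :=
  -- LANDED (wave 1, p73506): `Theorems/SnSubsetDichotomyNoThresholdSubsetTripleStubTransfer.lean`
  Summit.MatrixMultiplication.MatrixMultiplication.Theorems.stub_transfer F hC

/-- **Stub 2 — BCCGU 2017, Prop. 3.2 (= Prop. 13 of the held text): the codimension bound over
SUBSPACES (size M–L, provable now; shared verbatim with line `klr-graded-codimension`).**  For a finite
group `G`, a field `F` and `F`-subspaces `A, B, C` of `F[G]` with `A·B ⊆ C` (submodule product):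
`slice-rank_F D_G ≤ codim A + codim B + dim C`, written additively (no truncated subtraction;
`dim F[G] = |G|` via `MonoidAlgebra.coeffLinearEquiv` + `Module.finrank_finsupp_self`).
Proof (BCCGU): pick bases `(xᵢ)` of `F[G]` through `A` (leg 1), `(yⱼ)` through `B` (leg 2), `(z_k)`
through `C` (leg 3) (`Basis.extend` / `Submodule.exists_basis` over a field); in these coordinates
`D_G(x,y,z) = Σ_k P_C(k,z⁻¹) Σ_j Q_B(y,j) Σ_i Q_A(x,i)·c(i,j,k)` with `c(i,j,k)` = `z_k`-coordinate of
`xᵢ·yⱼ` (three-basis version of `GradedCoords.mulGroupTensor_eq_subst`), and `c(i,j,k) ≠ 0` forces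
`dx i + dy j ≤ dz k` for the indicator degrees `dx = 𝟙[xᵢ ∈ A-part]`, `dy = 𝟙[yⱼ ∈ B-part]`,
`dz = 1 + 𝟙[z_k ∈ C-part]` (because `A·B ⊆ C`); `HasSliceRankLE.of_graded` at thresholds `a = b = 1`
counts `#{dx < 1} = codim A`, `#{dy < 1} = codim B`, `#{dz ≥ 2} = dim C`, and
`HasSliceRankLE.subst_left/mid/right` undo the change of basis (slice rank is `GL³`-invariant).
[BlasiakChurchCohnGrochowUmans2017, Lemma 3.1 + Prop. 3.2 (held text p. 5, Prop. 13);
tree: `GradedCoords.hasSliceRankLE` is the one-basis special case, PROVED] -/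
theorem stub_codim (F : Type) [Field F] (G : Type) [Group G] [Fintype G] [DecidableEq G]
    (A B C : Submodule F (MonoidAlgebra F G)) (hABC : A * B ≤ C) :
    sliceRank (mulGroupTensor F G) + Module.finrank F A + Module.finrank F B ≤
      2 * Fintype.card G + Module.finrank F C :=
  -- LANDED (wave 1, p73866): `Theorems/SnSubsetDichotomyNoThresholdSubsetTripleStubCodim.lean`
  Summit.MatrixMultiplication.MatrixMultiplication.Theorems.stub_codim F G A B C hABC

/-- **Stub 3 — the semisimple floor is thin: LAYER 0 of the Loewy profile (size L–XL to formalise;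
known mathematics).**  `dim_𝕜 𝕜[S_n]/J(𝕜[S_n]) ≤ n!·e^{−K√n}` eventually.  Why true:
`𝕜[S_n]/J ≅ Π_λ M_{d_λ}(𝕜)` over the 2-regular (= strict) partitions `λ ⊢ n` (James: the simple
modules are `D^λ = S^λ/(S^λ ∩ S^{λ⊥})`, a quotient of the Specht module, so `d_λ ≤ f^λ`), hence
`n! − dim J = Σ_{λ strict} d_λ² ≤ Σ_{λ strict} (f^λ)² = #{σ ∈ S_n : RSK-shape(σ) strict}` (Schensted)
`≤ #{σ : LDS(σ)·(LDS(σ)+1) ≤ 2n}` (a strict shape with `ℓ` rows has `≥ ℓ(ℓ+1)/2` cells, and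
`ℓ(shape) = LDS`), and `LDS(σ)/√n → 2` in probability with lower tail
`P(LDS ≤ 1.42√n) ≤ e^{−K√n}` (Talagrand's concentration for the longest monotone subsequence already
gives `exp(−(0.58√n)²/(8·2√n)) = e^{−0.02√n}`; the true order is `e^{−Θ(n)}`, Deuschel–Zeitouni 1999 /
Seppäläinen 1998 lower-tail LDP at speed `n`).  COMPUTED (card + triage r1-1/2/3, exact hook formula):
`Pl_n(strict) = 9.98e-3, 3.93e-3, 1.62e-3, 6.44e-4, 2.50e-4` at `n = 40,…,80`, `−log/√n = 0.73 → 0.93`;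
`dim A/J = 5, 33, 289, 697` for `n = 4,…,7` (GAP j006679 = James' dimensions).  Necessary for ANY
radical-power witness (`J^a ⊆ J` for `a ≥ 1`), it is Cor. B.7's evasion made quantitative and Pratt's
lower bound `SR(k[G]) ≥ dim k[G]/J` read backwards.  Natural re-cut for a worker (not registered):
`n! − dim J ≤ #{σ : LDS(σ)(LDS(σ)+1) ≤ 2n}` (James + Schensted) and the LDS lower tail (probability).
[James1978 = LNM 682, Thm 11.5; Schensted1961; Talagrand1995 (IHES 81) §7 / DeuschelZeitouni1999
(CPC 8) / Seppalainen1998; Pratt2022 = arXiv:2210.05488 Lem. 2.2–2.5; BlasiakChurchCohnGrochowUmans2017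
Cor. B.7; LoganShepp1977 / VershikKerov1985 for `LDS/√n → 2`] -/
theorem stub_semisimpleFloor :
    ∃ K : ℝ, 0 < K ∧ ∃ n₀ : ℕ, ∀ n ≥ n₀,
      (n.factorial : ℝ) - (Module.finrank 𝕜 J⟦n⟧ : ℝ) ≤
        (n.factorial : ℝ) * Real.exp (-(K * Real.sqrt (n : ℝ))) := by
  sorry

/-- **Stub 4 — the radical of `𝕜[S_n]` has a thin Loewy window: LAYERS ≥ 1 (size XL; OPEN — the
load-bearing bet of the line, BCCGU Lemma 3.3 with `I = J`).**  For some `K > 0` and all large `n`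
there are `a, b` with `(dim J − dim J^a) + (dim J − dim J^b) + dim J^{a+b} ≤ n!·e^{−K√n}`; for
`a ≤ b` this says: the Loewy layers `r_i = dim J^i/J^{i+1}`, `i ≥ 1`, of the regular representation
put all but `n!·e^{−K√n}` of their mass in the window `b ≤ i < a+b` (length `a ≤` start `b`;
`a = b`: the middle third-type window `[a, 2a)`).  No junk: `J^0 = 𝕜·1`, so `a = 0` or `b = 0` makes the
left side `≥ 2·dim J − 1 ≈ 2n!`, and `a = b ≥ LL` gives `2·dim J`; a witness needs a middle-heavy
profile of Loewy length `LL(𝕜S_n) → ∞`.  Why it might hold: in characteristic 2 every block of `S_n`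
has weight up to `n/2`; the defect group `Syl₂ S_{2^k}` has Jennings–Loewy length `5, 15, 51 ≈ n²/6`
with a bell-shaped (binomial-type) layer profile whose BCCGU split is `e^{−Θ(n)}`-thin (card, computed
`k ≤ 4`, extrapolated `−log(ratio)/n ≈ 0.04`); if `LL(B₀(𝕜S_n)) ≳ n^{1/2+ε}` with CLT-type layer
statistics of width `≲ n^{3/4}` (the width MEASURED for the Brundan–Kleshchev degree statistic by the
sibling card, `sd ≈ 0.7·n^{3/4}`, `−log ρ₂(n)/√n ≈ 0.021` flat for `18 ≤ n ≤ 46`) the window exists.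
Why it might fail: NO numerical shadow yet — GAP j006679 (`𝔽₂S_n`, `n ≤ 7`): layers
`[5,9,5,5]`, `[33,25,9,18,9,9,17]`, `[289,49,50,…,50,49,33]`, `[697,993,958,766,797,729,100]`,
`LL = 4, 7, 10, 7`, top-heavy or FLAT, best split ratio `≥ 0.83`; `LL(B₀(𝔽₂S_n))` is not known to grow
faster than `O(w)` and the radical filtration of a 2-block need not track the KLR grading (negative
degrees, wild blocks, no Koszulity for non-abelian defect); `J(𝔽₂P)·𝔽₂S_n ⊄ J(𝔽₂S_n)` (`O₂(S_n) = 1`),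
so the defect-group calibration transfers nothing by itself (triage r1-3).  First test (card F1,
relocated): Loewy layers of the BASIC algebra of `B₀(𝔽₂S_n)`, `n = 8…12`, against `LL(𝔽₂ Syl₂) = 15`.
Blocks need no separate statement here: blocks of weight `≤ (1−ε)n/2` have Plancherel mass
`e^{−c(ε)√n}` (2-core tail), and a global window serves all heavier blocks at the price of a smaller `K`;
a per-block variant is the instance `A = ⊕_B J_B^{a_B}` of `stub_codim` if ever needed (lead's reshaping).
[BlasiakChurchCohnGrochowUmans2017 Lemma 3.3 / Prop. 3.10 / Thm 3.11 (Jennings profile ⇒ Hoeffding);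
Jennings1941; BlaserLysikov2020 (LIPIcs 170:17) Ex. 14, Cor. 23; KoshitaniKulshammerSambale2014
(doi:10.1017/s0305004114000103, Loewy lengths of blocks); Martin's conjecture `LL = 2w+1` for weight-`w`
blocks (ChuangTan2003 doi:10.1112/S0024611502013953 for Rouquier blocks, `w < p`); BrundanKleshchev2009
(arXiv:0808.2032) / HuMathas2010 for the grading; evidence: kit j006679 (this crux item)] -/
theorem stub_radicalWindow :
    ∃ K : ℝ, 0 < K ∧ ∃ n₀ : ℕ, ∀ n ≥ n₀, ∃ a b : ℕ,
      ((Module.finrank 𝕜 J⟦n⟧ : ℝ) - (Module.finrank 𝕜 ↥(J⟦n⟧ ^ a) : ℝ)) +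
        ((Module.finrank 𝕜 J⟦n⟧ : ℝ) - (Module.finrank 𝕜 ↥(J⟦n⟧ ^ b) : ℝ)) +
          (Module.finrank 𝕜 ↥(J⟦n⟧ ^ (a + b)) : ℝ) ≤
        (n.factorial : ℝ) * Real.exp (-(K * Real.sqrt (n : ℝ))) := by
  sorry

/-! ## Glue (sorry-free) -/

/-- Eventually `3 ≤ exp (K·√n)` for `K > 0` (used to absorb the constant of the three-term split into
the rate). -/
theorem eventually_three_le_exp {K : ℝ} (hK : 0 < K) :
    ∃ n₀ : ℕ, ∀ n ≥ n₀, (3 : ℝ) ≤ Real.exp (K * Real.sqrt (n : ℝ)) := by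
  have ht : Filter.Tendsto (fun n : ℕ => Real.exp (K * Real.sqrt (n : ℝ)))
      Filter.atTop Filter.atTop :=
    Real.tendsto_exp_atTop.comp
      ((Real.tendsto_sqrt_atTop.comp tendsto_natCast_atTop_atTop).const_mul_atTop hK)
  obtain ⟨n₀, h⟩ := Filter.eventually_atTop.1 (ht.eventually_ge_atTop 3)
  exact ⟨n₀, h⟩

/-- **`C⁺ = TwoModularSliceRank` from stubs 2–4** (BCCGU Lemma 3.3 with `I = J(𝕜[S_n])`):
`slice-rank_𝕜 D_{S_n} ≤ (n! − dim J^a) + (n! − dim J^b) + dim J^{a+b}`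
`= 2(n! − dim J) + [(dim J − dim J^a) + (dim J − dim J^b) + dim J^{a+b}]`
`≤ 2·n!e^{−K₁√n} + n!e^{−K₂√n} ≤ 3·n!e^{−K√n} ≤ n!e^{−(K/2)√n}` for `K = min(K₁,K₂)` and
`3 ≤ e^{(K/2)√n}`. -/
theorem twoModularSliceRank_of_stubs :
    ∃ K : ℝ, 0 < K ∧ ∃ n₀ : ℕ, ∀ n ≥ n₀,
      (sliceRank (mulGroupTensor 𝕜 (Equiv.Perm (Fin n))) : ℝ) ≤
        (n.factorial : ℝ) * Real.exp (-(K * Real.sqrt (n : ℝ))) := by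
  obtain ⟨K₁, hK₁, n₁, h₁⟩ := stub_semisimpleFloor
  obtain ⟨K₂, hK₂, n₂, h₂⟩ := stub_radicalWindow
  set K : ℝ := min K₁ K₂ with hKdef
  have hK0 : 0 < K := lt_min hK₁ hK₂
  obtain ⟨n₃, h₃⟩ := eventually_three_le_exp (K := K / 2) (by positivity)
  refine ⟨K / 2, by positivity, max (max n₁ n₂) n₃, fun n hn => ?_⟩
  have hn₁ : n₁ ≤ n := le_trans (le_max_left _ _) (le_trans (le_max_left _ _) hn)
  have hn₂ : n₂ ≤ n := le_trans (le_max_right _ _) (le_trans (le_max_left _ _) hn)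
  have hn₃ : n₃ ≤ n := le_trans (le_max_right _ _) hn
  obtain ⟨a, b, hab⟩ := h₂ n hn₂
  have hfloor := h₁ n hn₁
  have hthree := h₃ n hn₃
  -- the codimension bound with `A = J^a`, `B = J^b`, `C = J^(a+b)` (`J^a · J^b = J^(a+b)`)
  have hcod := stub_codim 𝕜 (Equiv.Perm (Fin n)) (J⟦n⟧ ^ a) (J⟦n⟧ ^ b) (J⟦n⟧ ^ (a + b))
    (le_of_eq (pow_add _ a b).symm)
  rw [Fintype.card_perm, Fintype.card_fin] at hcod
  have hcodR : (sliceRank (mulGroupTensor 𝕜 (Equiv.Perm (Fin n))) : ℝ) +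
      (Module.finrank 𝕜 ↥(J⟦n⟧ ^ a) : ℝ) + (Module.finrank 𝕜 ↥(J⟦n⟧ ^ b) : ℝ) ≤
        2 * (n.factorial : ℝ) + (Module.finrank 𝕜 ↥(J⟦n⟧ ^ (a + b)) : ℝ) := by
    exact_mod_cast hcod
  -- abbreviations
  set F : ℝ := (n.factorial : ℝ) with hF
  set s : ℝ := Real.sqrt (n : ℝ) with hs
  have hF0 : 0 ≤ F := Nat.cast_nonneg _
  -- monotonicity of the two exponential bounds in the rate
  have hE₁ : Real.exp (-(K₁ * s)) ≤ Real.exp (-(K * s)) := by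
    apply Real.exp_le_exp.2
    have : K ≤ K₁ := min_le_left _ _
    nlinarith [Real.sqrt_nonneg (n : ℝ)]
  have hE₂ : Real.exp (-(K₂ * s)) ≤ Real.exp (-(K * s)) := by
    apply Real.exp_le_exp.2
    have : K ≤ K₂ := min_le_right _ _
    nlinarith [Real.sqrt_nonneg (n : ℝ)]
  -- sum of the three pieces
  have hsum : (sliceRank (mulGroupTensor 𝕜 (Equiv.Perm (Fin n))) : ℝ) ≤
      3 * (F * Real.exp (-(K * s))) := by
    have h1 : F * Real.exp (-(K₁ * s)) ≤ F * Real.exp (-(K * s)) :=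
      mul_le_mul_of_nonneg_left hE₁ hF0
    have h2 : F * Real.exp (-(K₂ * s)) ≤ F * Real.exp (-(K * s)) :=
      mul_le_mul_of_nonneg_left hE₂ hF0
    linarith
  -- absorb the constant: `3 ≤ exp ((K/2)·s)`
  have hexp : 3 * (F * Real.exp (-(K * s))) ≤ F * Real.exp (-(K / 2 * s)) := by
    have hkey : Real.exp (-(K * s)) * Real.exp (K / 2 * s) = Real.exp (-(K / 2 * s)) := by
      rw [← Real.exp_add]
      congr 1
      ring
    have hpos : 0 ≤ F * Real.exp (-(K * s)) := mul_nonneg hF0 (Real.exp_pos _).le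
    calc 3 * (F * Real.exp (-(K * s)))
        ≤ Real.exp (K / 2 * s) * (F * Real.exp (-(K * s))) :=
          mul_le_mul_of_nonneg_right hthree hpos
      _ = F * (Real.exp (-(K * s)) * Real.exp (K / 2 * s)) := by ring
      _ = F * Real.exp (-(K / 2 * s)) := by rw [hkey]
  exact hsum.trans hexp

/-- **`NoThresholdSubsetTriple` from the line** (no hypotheses; uses only the four stubs and the
tree): `C⁺` over `𝔽̄₂` (`twoModularSliceRank_of_stubs`) fed to the transfer (`stub_transfer`). -/
theorem NoThresholdSubsetTriple_of : NoThresholdSubsetTriple :=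
  stub_transfer (AlgebraicClosure (ZMod 2)) twoModularSliceRank_of_stubs

end Summit.MatrixMultiplication.MatrixMultiplication.Cruxes.NoThresholdSubsetTriple.TwoModularLoewySliceRank
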